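import Literature.InformationTheory.QuantumCodes.HypergraphProductDimension
import Literature.InformationTheory.QuantumCodes.HypergraphProductDistance

/-!
# Hypergraph product: the distance upper bounds (Tillich–Zémor Lemma 10), the main theorem (Thm 1) and
the discharge of the named fact `TillichZemor2014_hgp_parameters`

Held text arXiv:0903.0566v1 [TillichZemor2014]: Lemma 10 (chunk p0008 L53-95), Theorem 1 = §6 (chunk
p0003 L71-80, p0009 L1-52). PROVED here:

* `minDist_le_holds : HypergraphProduct.minDist_le` — "Suppose `d₁ < ∞` and `d₂ᵀ < ∞`. Then `D ≤ d₁`.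
  Similarly, if `d₂ < ∞` and `d₁ᵀ < ∞`. Then `D ≤ d₂`." The paper's witness: a minimum-weight cycle `𝒵₁` of
  `ℋ₁` and a vertex `y` of `ℋ₂` with `{y}` not a cocycle of `ℋ₂ᵀ` give the cycle `{αy : α ∈ 𝒵₁}` of `ℋ`, of
  weight `d₁`, which is not a sum of chambers (in matrix form the vector `(c ⊗ e_y, 0)`).
* `mainTheorem_holds : HypergraphProduct.mainTheorem` — for a full-rank `(n−k) × n` parity-check matrix `H`
  of `C = [n,k,d]` the code `Q_{ℋ·ℋᵀ}` has `N − rank H_X − rank H_Z = k²` and `D = d`.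
* `TillichZemor2014_hgp_parameters_holds` — Thm 7 ∧ Thm 9 ∧ Lemma 10 (D-0014 discharge of the bundle).
-/

namespace Literature.InformationTheory.QuantumCodes

open Matrix Module
open scoped Kronecker

/-! ### The minimum distance is attained -/

section Attain

variable {F : Type*} [Field F] [DecidableEq F] {ι : Type*} [Fintype ι]

/-- A code of finite minimum distance has a nonzero codeword of that weight ("let `𝒵₁ ⊂ E₁` be a cycle of
`ℋ₁` of minimum weight `d₁`"). [cite: TillichZemor2014, proof of Lemma 10 (arXiv v1 chunk p0008 L63-65)] -/
theorem exists_hammingNorm_eq_minDist (C : Submodule F (ι → F)) (h : Coding.minDist C < ⊤) :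
    ∃ c ∈ C, c ≠ 0 ∧ (hammingNorm c : ℕ∞) = Coding.minDist C := by
  classical
  have hne : ∃ c ∈ C, c ≠ 0 := by
    by_contra hno
    have htop : (⊤ : ℕ∞) ≤ Coding.minDist C :=
      Coding.le_minDist_iff.2 fun c hc h0 => (hno ⟨c, hc, h0⟩).elim
    exact lt_irrefl _ (h.trans_le htop)
  obtain ⟨c₀, hc₀, h0⟩ := hne
  set S : Set ℕ := {n | ∃ c ∈ C, c ≠ 0 ∧ hammingNorm c = n} with hS_def
  have hS : S.Nonempty := ⟨_, c₀, hc₀, h0, rfl⟩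
  obtain ⟨c, hc, hc0, hcn⟩ := Nat.sInf_mem hS
  refine ⟨c, hc, hc0, le_antisymm ?_ (Coding.minDist_le_hammingNorm hc hc0)⟩
  refine Coding.le_minDist_iff.2 fun c' hc' h0' => ?_
  rw [hcn]
  exact_mod_cast Nat.sInf_le (show hammingNorm c' ∈ S from ⟨c', hc', h0', rfl⟩)

end Attain

namespace HypergraphProduct

variable {V₁ E₁ V₂ E₂ : Type*}
variable [Fintype V₁] [Fintype E₁] [Fintype V₂] [Fintype E₂]
variable [DecidableEq V₁] [DecidableEq E₁] [DecidableEq V₂] [DecidableEq E₂]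

/-! ### Lemma 10 -/

omit [DecidableEq E₂] in
/-- If the cycle code of `ℋ₂ᵀ` is nonzero then some vertex `y` of `ℋ₂` has `{y}` not a cocycle of `ℋ₂ᵀ`
(i.e. the unit vector `e_y` is not in the row space of `H₂ᵀ` = column space of `H₂`): "Otherwise the cocycle
code of `ℋ₂ᵀ` is the whole space … but we have supposed `d₂ᵀ < ∞`, meaning that the cycle code of `ℋ₂ᵀ` is not
`{0}`". Proved. [cite: TillichZemor2014, proof of Lemma 10 (arXiv v1 chunk p0008 L66-74)] -/
theorem exists_single_notMem_rowSpace (H₂ : Matrix V₂ E₂ (ZMod 2)) (h : pcCode H₂ᵀ ≠ ⊥) :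
    ∃ y : V₂, Pi.single y (1 : ZMod 2) ∉ rowSpace H₂ᵀ := by
  by_contra hall
  simp only [not_exists, not_not] at hall
  apply h
  rw [Submodule.eq_bot_iff]
  intro u hu
  ext y
  obtain ⟨v, hv⟩ := (mem_rowSpace_iff _ _).1 (hall y)
  have hy : u y = Pi.single y (1 : ZMod 2) ⬝ᵥ u := by rw [single_dotProduct, one_mul]
  rw [Pi.zero_apply, hy, ← hv, ← Matrix.dotProduct_mulVec, (mem_pcCode_iff _ _).1 hu, dotProduct_zero]

omit [DecidableEq E₁] [DecidableEq E₂] in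
/-- The witness of Lemma 10 (first clause) is a cycle: for `c ∈ Z(ℋ₁)` and a vertex `y` of `ℋ₂`, the set of
edges `{αy : α ∈ c}` — the vector `(c ⊗ e_y, 0)` — lies in `ker H_X`. Proved.
[cite: TillichZemor2014, proof of Lemma 10 (arXiv v1 chunk p0008 L75-79: "It is easy to check that `𝒵` is a cycle of `ℋ`")] -/
theorem witness₁_mem (H₁ : Matrix V₁ E₁ (ZMod 2)) (H₂ : Matrix V₂ E₂ (ZMod 2)) {c : E₁ → ZMod 2}
    (hc : c ∈ pcCode H₁) (y : V₂) :
    glue (Matrix.vecMulVec c (Pi.single y 1)) (0 : Matrix V₁ E₂ (ZMod 2)) ∈ pcCode (xMatrix H₁ H₂) := by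
  rw [mem_pcCode_xMatrix_iff, partR_glue, partL_glue, Matrix.zero_mul, add_zero, Matrix.mul_vecMulVec]
  simp [(mem_pcCode_iff _ _).1 hc]

omit [Fintype V₁] [Fintype V₂] [DecidableEq V₁] in
/-- The witness of Lemma 10 (first clause) is not a sum of chambers when `c ≠ 0` and `{y}` is not a cocycle of
`ℋ₂ᵀ`: a decomposition would give `{y} = ∑ β`, a cocycle. Proved.
[cite: TillichZemor2014, proof of Lemma 10 (arXiv v1 chunk p0008 L80-93)] -/
theorem witness₁_notMem (H₁ : Matrix V₁ E₁ (ZMod 2)) (H₂ : Matrix V₂ E₂ (ZMod 2)) {c : E₁ → ZMod 2}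
    (hc0 : c ≠ 0) {y : V₂} (hy : Pi.single y (1 : ZMod 2) ∉ rowSpace H₂ᵀ) :
    glue (Matrix.vecMulVec c (Pi.single y 1)) (0 : Matrix V₁ E₂ (ZMod 2)) ∉ rowSpace (zMatrix H₁ H₂) := by
  rw [mem_rowSpace_zMatrix_iff, partR_glue, partL_glue]
  rintro ⟨G, hG, -⟩
  obtain ⟨α, hα⟩ := Function.ne_iff.1 hc0
  apply hy
  have hrow : c α • (Pi.single y (1 : ZMod 2)) = G α ᵥ* H₂ᵀ := by
    ext b
    have hb := congrFun (congrFun hG α) b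
    rw [Matrix.vecMulVec_apply, Matrix.mul_apply] at hb
    rw [Pi.smul_apply, smul_eq_mul, hb]
    rfl
  have hmem : c α • Pi.single y (1 : ZMod 2) ∈ rowSpace H₂ᵀ := (mem_rowSpace_iff _ _).2 ⟨G α, hrow.symm⟩
  exact (Submodule.smul_mem_iff _ hα).1 hmem

omit [DecidableEq V₁] [DecidableEq E₁] [DecidableEq E₂] in
/-- The witness of Lemma 10 (first clause) has weight `|c|` ("`|𝒵| = |𝒵₁| = d₁`"). Proved.
[cite: TillichZemor2014, proof of Lemma 10 (arXiv v1 chunk p0008 L77-78)] -/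
theorem hammingNorm_witness₁ (c : E₁ → ZMod 2) (y : V₂) :
    hammingNorm (glue (Matrix.vecMulVec c (Pi.single y 1)) (0 : Matrix V₁ E₂ (ZMod 2))) = hammingNorm c := by
  unfold hammingNorm
  symm
  refine Finset.card_bij (fun α _ => Sum.inl (α, y)) (fun α hα => ?_) (fun α _ α' _ h => by simpa using h)
    (fun x hx => ?_)
  · rw [Finset.mem_filter] at hα ⊢
    refine ⟨Finset.mem_univ _, ?_⟩
    rw [glue_inl, Matrix.vecMulVec_apply, Pi.single_eq_same, mul_one]
    exact hα.2
  · rw [Finset.mem_filter] at hx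
    rcases x with ⟨α, b⟩ | ⟨a, β⟩
    · rw [glue_inl, Matrix.vecMulVec_apply] at hx
      by_cases hb : b = y
      · subst hb
        rw [Pi.single_eq_same, mul_one] at hx
        exact ⟨α, by rw [Finset.mem_filter]; exact ⟨Finset.mem_univ _, hx.2⟩, rfl⟩
      · rw [Pi.single_eq_of_ne hb, mul_zero] at hx
        exact (hx.2 rfl).elim
    · rw [glue_inr] at hx
      exact (hx.2 rfl).elim

omit [DecidableEq E₁] [DecidableEq E₂] in
/-- The witness of Lemma 10 (second clause), `(0, e_x ⊗ c)` for `c ∈ Z(ℋ₂)` and a vertex `x` of `ℋ₁`, is a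
cycle. Proved. [cite: TillichZemor2014, proof of Lemma 10 (arXiv v1 chunk p0008 L94-95: "The second is obtained analogously")] -/
theorem witness₂_mem (H₁ : Matrix V₁ E₁ (ZMod 2)) (H₂ : Matrix V₂ E₂ (ZMod 2)) {c : E₂ → ZMod 2}
    (hc : c ∈ pcCode H₂) (x : V₁) :
    glue (0 : Matrix E₁ V₂ (ZMod 2)) (Matrix.vecMulVec (Pi.single x 1) c) ∈ pcCode (xMatrix H₁ H₂) := by
  rw [mem_pcCode_xMatrix_iff, partR_glue, partL_glue, Matrix.mul_zero, zero_add, Matrix.vecMulVec_mul,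
    Matrix.vecMul_transpose]
  simp only [(mem_pcCode_iff _ _).1 hc]
  ext a β
  simp [Matrix.vecMulVec_apply]

omit [Fintype V₁] [Fintype V₂] [DecidableEq V₂] in
/-- The witness of Lemma 10 (second clause) is not a sum of chambers when `c ≠ 0` and `{x}` is not a cocycle of
`ℋ₁ᵀ`. Proved. [cite: TillichZemor2014, proof of Lemma 10 (arXiv v1 chunk p0008 L80-95)] -/
theorem witness₂_notMem (H₁ : Matrix V₁ E₁ (ZMod 2)) (H₂ : Matrix V₂ E₂ (ZMod 2)) {c : E₂ → ZMod 2}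
    (hc0 : c ≠ 0) {x : V₁} (hx : Pi.single x (1 : ZMod 2) ∉ rowSpace H₁ᵀ) :
    glue (0 : Matrix E₁ V₂ (ZMod 2)) (Matrix.vecMulVec (Pi.single x 1) c) ∉ rowSpace (zMatrix H₁ H₂) := by
  rw [mem_rowSpace_zMatrix_iff, partR_glue, partL_glue]
  rintro ⟨G, -, hG⟩
  obtain ⟨β, hβ⟩ := Function.ne_iff.1 hc0
  apply hx
  have hcol : c β • (Pi.single x (1 : ZMod 2)) = (fun α => G α β) ᵥ* H₁ᵀ := by
    ext a
    have ha := congrFun (congrFun hG a) β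
    rw [Matrix.vecMulVec_apply, Matrix.mul_apply] at ha
    rw [Pi.smul_apply, smul_eq_mul, mul_comm, ha, Matrix.vecMul_transpose, Matrix.mulVec, dotProduct]
  have hmem : c β • Pi.single x (1 : ZMod 2) ∈ rowSpace H₁ᵀ :=
    (mem_rowSpace_iff _ _).2 ⟨fun α => G α β, hcol.symm⟩
  exact (Submodule.smul_mem_iff _ hβ).1 hmem

omit [DecidableEq E₁] [DecidableEq V₂] [DecidableEq E₂] in
/-- The witness of Lemma 10 (second clause) has weight `|c|`. Proved.
[cite: TillichZemor2014, proof of Lemma 10 (arXiv v1 chunk p0008 L94-95)] -/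
theorem hammingNorm_witness₂ (c : E₂ → ZMod 2) (x : V₁) :
    hammingNorm (glue (0 : Matrix E₁ V₂ (ZMod 2)) (Matrix.vecMulVec (Pi.single x 1) c)) = hammingNorm c := by
  unfold hammingNorm
  symm
  refine Finset.card_bij (fun β _ => Sum.inr (x, β)) (fun β hβ => ?_) (fun β _ β' _ h => by simpa using h)
    (fun e he => ?_)
  · rw [Finset.mem_filter] at hβ ⊢
    refine ⟨Finset.mem_univ _, ?_⟩
    rw [glue_inr, Matrix.vecMulVec_apply, Pi.single_eq_same, one_mul]
    exact hβ.2
  · rw [Finset.mem_filter] at he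
    rcases e with ⟨α, b⟩ | ⟨a, β⟩
    · rw [glue_inl] at he
      exact (he.2 rfl).elim
    · rw [glue_inr, Matrix.vecMulVec_apply] at he
      by_cases ha : a = x
      · subst ha
        rw [Pi.single_eq_same, one_mul] at he
        exact ⟨β, by rw [Finset.mem_filter]; exact ⟨Finset.mem_univ _, he.2⟩, rfl⟩
      · rw [Pi.single_eq_of_ne ha, zero_mul] at he
        exact (he.2 rfl).elim

/-- **Tillich–Zémor Lemma 10, proved**: discharges the named fact `HypergraphProduct.minDist_le` — if
`d₁ < ∞` and `d₂ᵀ < ∞` then `D ≤ d₁`; if `d₂ < ∞` and `d₁ᵀ < ∞` then `D ≤ d₂`.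
[cite: TillichZemor2014, Lemma 10 (arXiv v1 chunk p0008 L57-62)] -/
theorem minDist_le_holds : minDist_le := by
  intro V₁ E₁ V₂ E₂ _ _ _ _ _ _ _ _ H₁ H₂
  constructor
  · intro h₁ h₂T
    obtain ⟨c, hc, hc0, hcw⟩ := exists_hammingNorm_eq_minDist _ h₁
    have hbot : pcCode H₂ᵀ ≠ ⊥ := by
      intro hb
      rw [hb, Coding.minDist_bot] at h₂T
      exact lt_irrefl _ h₂T
    obtain ⟨y, hy⟩ := exists_single_notMem_rowSpace H₂ hbot
    rw [← hcw, ← hammingNorm_witness₁ (V₁ := V₁) (E₂ := E₂) c y]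
    exact cssMinDist_le_hammingNorm (Or.inl ⟨witness₁_mem H₁ H₂ hc y, witness₁_notMem H₁ H₂ hc0 hy⟩)
  · intro h₂ h₁T
    obtain ⟨c, hc, hc0, hcw⟩ := exists_hammingNorm_eq_minDist _ h₂
    have hbot : pcCode H₁ᵀ ≠ ⊥ := by
      intro hb
      rw [hb, Coding.minDist_bot] at h₁T
      exact lt_irrefl _ h₁T
    obtain ⟨x, hx⟩ := exists_single_notMem_rowSpace H₁ hbot
    rw [← hcw, ← hammingNorm_witness₂ (E₁ := E₁) (V₂ := V₂) c x]
    exact cssMinDist_le_hammingNorm (Or.inl ⟨witness₂_mem H₁ H₂ hc x, witness₂_notMem H₁ H₂ hc0 hx⟩)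

/-! ### Theorem 1 (§6) and the bundle -/

/-- **Tillich–Zémor Theorem 1 (= §6), proved**: discharges `HypergraphProduct.mainTheorem` — for a full-rank
`(n−k) × n` parity-check matrix `H` of `C = [n,k,d]`, the code `Q_{ℋ·ℋᵀ}` (check matrices `xMatrix H Hᵀ`,
`zMatrix H Hᵀ` on `n² + (n−k)²` qubits) has dimension `k²` and minimum distance exactly `d` (`r = h = 0`,
`s = k`, `d₂ = d₁ᵀ = ∞`, `d₂ᵀ = d₁ = d`: Thm 7 gives `k²`, Thm 9 gives `D ≥ d`, Lemma 10 gives `D ≤ d`).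
[cite: TillichZemor2014, Thm 1 (arXiv v1 chunk p0003 L71-80) and §6 (chunk p0009 L1-52)] -/
theorem mainTheorem_holds : mainTheorem := by
  intro m n H hH
  -- full rank: `ker Hᵀ = 0`, `dim ker H = n - m`
  have hkT : Module.finrank (ZMod 2) (pcCode Hᵀ) = 0 := by
    have h := rank_add_finrank_pcCode Hᵀ
    rw [Matrix.rank_transpose, hH, Fintype.card_fin] at h
    omega
  have hk : (Module.finrank (ZMod 2) (pcCode H) : ℤ) = n - m := by
    have h := rank_add_finrank_pcCode H
    rw [hH, Fintype.card_fin] at h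
    omega
  have hbot : pcCode Hᵀ = ⊥ := Submodule.finrank_eq_zero.1 hkT
  constructor
  · obtain ⟨-, h2⟩ := dimension_eq_holds (Fin m) (Fin n) (Fin n) (Fin m) H Hᵀ
    simp only [Fintype.card_fin] at h2
    rw [h2, hkT, hk]
    push_cast
    ring
  · refine le_antisymm ?_ ?_
    · by_cases hd : Coding.minDist (pcCode H) < ⊤
      · refine (minDist_le_holds (Fin m) (Fin n) (Fin n) (Fin m) H Hᵀ).1 hd ?_
        rwa [Matrix.transpose_transpose]
      · rw [not_lt_top_iff] at hd
        rw [hd]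
        exact le_top
    · have hge := minDist_ge_holds (Fin m) (Fin n) (Fin n) (Fin m) H Hᵀ
      rw [Matrix.transpose_transpose, hbot, Coding.minDist_bot, min_top_right, min_top_left, min_self]
        at hge
      exact hge

end HypergraphProduct

/-- **The parameters of the hypergraph product, proved** (D-0014 discharge of the named fact
`TillichZemor2014_hgp_parameters`): Tillich–Zémor's Theorem 7 (dimension), Theorem 9 (`D ≥ min(d₁,d₂,d₁ᵀ,d₂ᵀ)`)
and Lemma 10 (upper bounds) hold for every pair of binary parity-check matrices.
[cite: TillichZemor2014, Thm 7, Thm 9, Lemma 10 (arXiv v1 chunks p0007 L126-135, p0008 L11-15, L57-62)] -/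
theorem TillichZemor2014_hgp_parameters_holds : TillichZemor2014_hgp_parameters :=
  ⟨HypergraphProduct.dimension_eq_holds, HypergraphProduct.minDist_ge_holds,
    HypergraphProduct.minDist_le_holds⟩

/-- **Tillich–Zémor Theorem 9** under the name the LADDER-QEC plan uses for the wave-1 proof item
(PARTITION v2.1 item 04.TZ9 `TillichZemor2014_theorem9_holds`): `D ≥ min(d₁,d₂,d₁ᵀ,d₂ᵀ)` for the quantum code
of every product hypergraph `ℋ₁·ℋ₂` — the same theorem as `HypergraphProduct.minDist_ge_holds` (the modern
`HGP(H₁,H₂) = Q_{ℋ₁·ℋ₂ᵀ}` instance is `Summit.Ventures.QEC.HGP.distance_ge`).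
[cite: TillichZemor2014, Thm 9 (arXiv v1 chunk p0008 L11-15)] -/
theorem TillichZemor2014_theorem9_holds : HypergraphProduct.minDist_ge :=
  HypergraphProduct.minDist_ge_holds

/-- **Tillich–Zémor Theorem 7** under a plan-style name: the dimension theorem for every `ℋ₁·ℋ₂`
(= `HypergraphProduct.dimension_eq_holds`; modern instance `Summit.Ventures.QEC.HGP.k_eq`).
[cite: TillichZemor2014, Thm 7 (arXiv v1 chunk p0007 L126-135)] -/
theorem TillichZemor2014_theorem7_holds : HypergraphProduct.dimension_eq :=
  HypergraphProduct.dimension_eq_holds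

/-- **Tillich–Zémor Lemma 10** under a plan-style name (= `HypergraphProduct.minDist_le_holds`).
[cite: TillichZemor2014, Lemma 10 (arXiv v1 chunk p0008 L57-62)] -/
theorem TillichZemor2014_lemma10_holds : HypergraphProduct.minDist_le :=
  HypergraphProduct.minDist_le_holds

/-- **Tillich–Zémor Theorem 1 (§6)** under a plan-style name (= `HypergraphProduct.mainTheorem_holds`):
`[[n² + (n−k)², k², d]]` from a full-rank parity-check matrix of an `[n,k,d]` code.
[cite: TillichZemor2014, Thm 1 (arXiv v1 chunk p0003 L71-80)] -/
theorem TillichZemor2014_theorem1_holds : HypergraphProduct.mainTheorem :=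
  HypergraphProduct.mainTheorem_holds

end Literature.InformationTheory.QuantumCodes
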